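import Summits.QuantumFields.YangMills.Theorems.AlphaInputsT3ACv3LinearLiftFlux
import Summits.QuantumFields.YangMills.Theorems.AlphaInputsT3ACv3AbelianRegion
import HarnessLib

/-!
# `AlphaInputsT3ACv3LinearLiftFluxLoopSum` — «FLUX-LIFT §7»: THE CORNER-EXCUSED LOOP-SUM BOUND (the (0.4) loops of EVERY coarse bond avoid the wrap-corner plaquettes, so a curl
# bound OFF the corner columns already controls all loop sums) — cell `ym3-torus`, width seat `ym-ust-20520-w5` (g8), line «SYM-CENTRE» (EX cure (ii-a)); feeds ★w4-20520 g9's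
# `diag_mem_fibre_diag_of_loopSum_T3` (R4-FIBRE, pointwise loop-sum guards)

WHY.  The flux-sector lift `a = liftL θ′ + 2π·Σ q_{μν} w_{μν}` of (R4) has small curl everywhere EXCEPT on the wrap-corner plaquettes `{x : x_μ = −1 ∧ x_ν = −1}` of each direction pair,
where the integer defect `−2πq` sits (✓`exists_fluxLift`); the printed `exp[mean log]` average equals the abelian closed form as soon as the (0.4) LOOP SUMS are small
(✓`blockAvg_gexpAt_apply`, ★w4's `…_of_loopSum_lt` tower).  LOCATED GEOMETRY (this seat, bus 22:56Z): every (0.4) loop of a coarse bond `c` lies in the two blocks `B(c₋) ∪ B(c₊)`, and a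
wrap-corner plaquette has its lower-left and upper-right corners in blocks that differ in BOTH `μ` and `ν` (labels `−1` and `0`), while `c₋, c₊` differ in ONE coordinate — so NO loop
of ANY bond sees a corner plaquette.  The tree already has the two-block Stokes bound ✓`abs_loopSum_le_twoBlock` (★alpha-2); THIS FILE turns it into: §1 `blockOf_apply_eq_neg_one`,
`blockOf_shift_shift_apply_eq_zero` (the two corner blocks' labels), ★`not_corner_of_twoBlock` (a plaquette whose extreme corners lie in blocks among `{c₋, c₊}` is not a wrap-corner
plaquette); §2 ★★`abs_loopSum_le_of_curl_off_corner` — `|loopSum a c i| ≤ (π/2)(((d+2)L)²/4)·B` for EVERY `c, i` from `|curl a| ≤ B` OFF the corner columns only; §3 the level-`s`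
packaging `abs_loopSum_linAvgIter_le_of_curl_off_corner` in the shape of ★w4's `hloop`.
HONEST FRAMING.  Lattice bookkeeping over ★alpha-2's two-block Stokes bound; nothing of [Balaban] asserted; count-neutral helper toward EX (`--supports stmt-QuantumFields-19200 --as helper`);
def-free; every landed file untouched.  YM₃ on the torus is a RUNG (R3), not the Clay problem; no claim about d = 4, infinite volume or a mass gap; nothing of the stub ∕ crux is claimed.

References: T. Bałaban, Commun. Math. Phys. 98 (1985) 17–51 [Balaban1985Averaging] ((19)–(20) p.21: the loop variables and their Stokes bound); Commun. Math. Phys. 109 (1987) 249–301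
[Balaban1987RG1] ((0.3)–(0.4) pp.252–253: the loops stay in the two blocks of the coarse bond).
-/

set_option autoImplicit false

noncomputable section

namespace Summit.QuantumFields.YangMills.Theorems.LinearLiftFlux

open scoped BigOperators
open Literature.MathematicalPhysics.QuantumFieldTheory.Balaban1983to89
open Literature.MathematicalPhysics.QuantumFieldTheory.Balaban1983to89.BlockAveraging (Idx)
open Literature.MathematicalPhysics.QuantumFieldTheory.Balaban1985CMP102.Setting
open Summit.QuantumFields.YangMills.Theorems.AbelianEML

variable {P : Params} {j : ℕ}

/-! ## §1 The blocks of the two extreme corners of a wrap-corner plaquette -/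

/-- The block of a site whose `κ`-th label is the last one has the last `κ`-th block label. [cite: Balaban1987RG1, (0.1) p.252] -/
theorem blockOf_apply_eq_neg_one (hj : j + 1 ≤ P.m + P.K) (x : Site P j) {κ : Fin P.d} (hx : x κ = -1) : blockOf x κ = -1 := by
  have hM := P.one_lt_sitesPerDir (j + 1)
  have hL := P.hL.2
  have hmul : P.sitesPerDir j = P.sitesPerDir (j + 1) * P.L := P.sitesPerDir_eq_mul_succ hj
  rw [eq_neg_one_iff_val, Site.val_blockOf hj, (eq_neg_one_iff_val _).mp hx, hmul]
  have h1 : P.sitesPerDir (j + 1) * P.L - 1 = (P.sitesPerDir (j + 1) - 1) * P.L + (P.L - 1) := by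
    obtain ⟨M', hM'⟩ : ∃ M', P.sitesPerDir (j + 1) = M' + 1 := ⟨P.sitesPerDir (j + 1) - 1, by omega⟩
    obtain ⟨L', hL'⟩ : ∃ L', P.L = L' + 1 := ⟨P.L - 1, by omega⟩
    rw [hM', hL', Nat.add_sub_cancel, Nat.add_sub_cancel]
    have : (M' + 1) * (L' + 1) = (M' * (L' + 1) + L') + 1 := by ring
    omega
  rw [h1, Nat.mul_comm, Nat.mul_add_div P.L_pos, Nat.div_eq_of_lt (by omega), Nat.add_zero]

/-- The block of `x + e_μ + e_ν` has `κ`-th label `0` when `x_κ = −1` and `κ ∈ {μ, ν}` is hit exactly once (`μ ≠ ν`). [cite: Balaban1987RG1, (0.1) p.252] -/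
theorem blockOf_shift_shift_apply_eq_zero (hj : j + 1 ≤ P.m + P.K) (x : Site P j) {μ ν κ : Fin P.d} (hμν : μ ≠ ν) (hκ : κ = μ ∨ κ = ν) (hx : x κ = -1) :
    blockOf ((x.shift μ).shift ν) κ = 0 := by
  have hcoord : ((x.shift μ).shift ν) κ = 0 := by
    rcases hκ with rfl | rfl
    · rw [Site.shift_apply, if_neg hμν, Site.shift_apply, if_pos rfl, hx, neg_add_cancel]
    · rw [Site.shift_apply, if_pos rfl, Site.shift_apply, if_neg (Ne.symm hμν), hx, neg_add_cancel]
  have hv : (((x.shift μ).shift ν) κ).val = 0 := by rw [hcoord, ZMod.val_zero]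
  have h0 : (blockOf ((x.shift μ).shift ν) κ).val = 0 := by rw [Site.val_blockOf hj, hv, Nat.zero_div]
  exact (ZMod.val_eq_zero _).mp h0

/-- `−1 ≠ 0` in `ZMod M` for `M > 1`. [folklore] -/
theorem neg_one_ne_zero_sites (i : ℕ) : (-1 : ZMod (P.sitesPerDir i)) ≠ 0 := by
  have hM := P.one_lt_sitesPerDir i
  intro h
  have h1 : ((1 : ZMod (P.sitesPerDir i))) = 0 := by rw [← neg_neg (1 : ZMod (P.sitesPerDir i)), h, neg_zero]
  have h2 := (ZMod.val_eq_zero (1 : ZMod (P.sitesPerDir i))).mpr h1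
  rw [ZMod.val_one] at h2
  exact one_ne_zero h2

/-- **★ A PLAQUETTE WHOSE EXTREME CORNERS LIE IN BLOCKS AMONG `{c₋, c₊}` IS NOT A WRAP-CORNER PLAQUETTE**: the two corner blocks of a wrap-corner plaquette differ in both `μ` and
`ν`, the two blocks of a coarse bond in at most one coordinate. [cite: Balaban1987RG1, (0.3)-(0.4) pp.252-253] -/
theorem not_corner_of_twoBlock (hj : j + 1 ≤ P.m + P.K) (c : PBond P (j + 1)) (x : Site P j) {μ ν : Fin P.d} (hμν : μ ≠ ν)
    (h1 : blockOf x = c.src ∨ blockOf x = c.tgt) (h2 : blockOf ((x.shift μ).shift ν) = c.src ∨ blockOf ((x.shift μ).shift ν) = c.tgt) :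
    ¬ (x μ = -1 ∧ x ν = -1) := by
  rintro ⟨hxμ, hxν⟩
  have aμ := blockOf_apply_eq_neg_one hj x hxμ
  have aν := blockOf_apply_eq_neg_one hj x hxν
  have bμ := blockOf_shift_shift_apply_eq_zero hj x hμν (Or.inl rfl) hxμ
  have bν := blockOf_shift_shift_apply_eq_zero hj x hμν (Or.inr rfl) hxν
  have hne := neg_one_ne_zero_sites (P := P) (j + 1)
  have htgt : ∀ κ : Fin P.d, c.tgt κ = if κ = c.dir then c.src c.dir + 1 else c.src κ := fun κ => by rw [PBond.tgt, Site.shift_apply]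
  -- compare the `μ`- and `ν`-labels of the two blocks in the four cases
  rcases h1 with h1 | h1 <;> rcases h2 with h2 | h2
  · exact hne (by rw [← aμ, h1, ← h2, bμ])
  · have eμ := htgt μ; have eν := htgt ν
    rw [← h2, bμ, ← h1, aμ] at eμ; rw [← h2, bν, ← h1, aν] at eν
    by_cases hdμ : μ = c.dir
    · rw [if_neg (fun h => hμν (hdμ.trans h.symm))] at eν; exact hne eν.symm
    · rw [if_neg hdμ] at eμ; exact hne eμ.symm
  · have eμ := htgt μ; have eν := htgt ν
    rw [← h1, aμ, ← h2, bμ] at eμ; rw [← h1, aν, ← h2, bν] at eν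
    by_cases hdμ : μ = c.dir
    · rw [if_neg (fun h => hμν (hdμ.trans h.symm))] at eν; exact hne eν
    · rw [if_neg hdμ] at eμ; exact hne eμ
  · exact hne (by rw [← aμ, h1, ← h2, bμ])

/-! ## §2 The corner-excused loop-sum bound -/

variable {G : Type} [GaugeGroup G] [MeasurableSpace G] (𝔊 : GroupModel G) {X : Matrix (Fin 𝔊.N) (Fin 𝔊.N) ℂ}

/-- **★★ THE CORNER-EXCUSED LOOP-SUM BOUND**: if `|curl a(x;μν)| ≤ B` at every fine plaquette EXCEPT possibly the wrap-corner ones `x_μ = x_ν = −1`, then EVERY (0.4) loop sum of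
EVERY coarse bond is `≤ (π/2)·(((d+2)L)²/4)·B` (standing range; one nonzero direction `X` of a group as printed runs the tree's Stokes bound).
[cite: Balaban1985Averaging, (19)-(20) p.21; Balaban1987RG1, (0.4) p.253] -/
theorem abs_loopSum_le_of_curl_off_corner (hj : j + 1 ≤ P.m + P.K) (hX : X ∈ 𝔊.lie) (hX0 : X ≠ 0) (a : PBond P j → ℝ) {B : ℝ} (hB0 : 0 ≤ B)
    (hB : ∀ (x : Site P j) (μ ν : Fin P.d), μ ≠ ν → ¬ (x μ = -1 ∧ x ν = -1) → |curlAt a x μ ν| ≤ B)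
    (c : PBond P (j + 1)) (i : Idx P) :
    |loopSum a c i| ≤ Real.pi / 2 * (((((P.d + 2) * P.L : ℕ) : ℝ) ^ 2 / 4) * B) :=
  abs_loopSum_le_twoBlock 𝔊 hj hX hX0 a hB0 c
    (fun p h1 h2 => hB p.src p.μ p.ν (ne_of_lt p.hμν) (not_corner_of_twoBlock hj c p.src (ne_of_lt p.hμν) h1 h2)) i

/-! ## §3 Level-`s` packaging for the pointwise loop-sum tower -/

/-- **THE LEVEL-`s` FORM** (the shape of ★w4's `hloop`): corner-excused curl bounds `B_s` at every level `s < k` of the iterated linear averages give loop-sum bounds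
`(π/2)(((d+2)L)²/4)·B_s` at every level. [cite: Balaban1987RG1, (0.4)+(0.11) p.253] -/
theorem abs_loopSum_linAvgIter_le_of_curl_off_corner (hX : X ∈ 𝔊.lie) (hX0 : X ≠ 0) (k : ℕ) (hk : k ≤ P.m + P.K) (a : PBond P 0 → ℝ) (Bs : ℕ → ℝ)
    (hB0 : ∀ s, 0 ≤ Bs s)
    (hB : ∀ s, s < k → ∀ (x : Site P s) (μ ν : Fin P.d), μ ≠ ν → ¬ (x μ = -1 ∧ x ν = -1) → |curlAt (linAvgIter s a) x μ ν| ≤ Bs s) :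
    ∀ s, s < k → ∀ (c : PBond P (s + 1)) (i : Idx P), |loopSum (linAvgIter s a) c i| ≤ Real.pi / 2 * (((((P.d + 2) * P.L : ℕ) : ℝ) ^ 2 / 4) * Bs s) :=
  fun s hs c i => abs_loopSum_le_of_curl_off_corner 𝔊 (by omega) hX hX0 (linAvgIter s a) (hB0 s) (hB s hs) c i

end Summit.QuantumFields.YangMills.Theorems.LinearLiftFlux

end
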